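import Summits.FinalStateConjecture.FinalStateConjecture.Theorems.ZeroEnergyKerrOrBombErgoregionBombModTRiccatiLogDivergence

/-!
# `ErgoregionBombModT` — brick N3 of line `SketchIdeator4` (zero-energy escape):
# logarithmic divergence at a finite end — both ends of the parameter domain are infinite

Route `ZeroEnergyKerrOrBomb` of the Final State Conjecture, crux
`Summit.FinalStateConjecture.FinalStateConjecture.Theses.ZeroEnergyKerrOrBomb.ErgoregionBombModT`
(stmt-FinalStateConjecture-17838), line `SketchIdeator4`, registered stub
`stub_logDivergenceAtFiniteEnd` (N3).

Pure one-variable calculus.  On an open, order-connected, non-empty set `s ⊆ ℝ` (an open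
interval) we are given real functions with `φ' = u`, `u' = w`, `|φ| ≤ M`, together with the
quantitative escape law of the line: `δ / (sup s - t)² ≤ w t` on `s` if `s` is bounded above, and
`δ / (t - inf s)² ≤ w t` on `s` if `s` is bounded below (`δ > 0`).  We prove that `s` is bounded
neither above nor below.

* UPPER END with an explicit end-point `b` (`false_of_upper_end`): on `[t₀, b)` apply the landed
  brick R23 `stub_riccatiLogDivergence` (p154806) with `ρ t := (b - t)⁻¹`, `v := ρ²`, `c := δ`,
  `C := 1`: indeed `ρ' = ρ²`, `ρ > 0`, `δ ρ² = δ / (b - t)² ≤ w`, `|v| ≤ 1 · ρ²`, and `ρ` is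
  unbounded on `[t₀, b)` (`ρ ≥ n + 1` at `max t₀ (b - 1/(n+1))`).  R23 makes `φ` unbounded above
  on `[t₀, b)`, against `|φ| ≤ M`.
* If `s` is bounded above, take `b := sup s`: a point `t₀ ∈ s` has `t₀ < b` (`s` is open) and
  `[t₀, b) ⊆ s` (`s` is order-connected).
* If `s` is bounded below, reflect `t ↦ -t`: `φ̂ := φ ∘ neg`, `û := -u ∘ neg`, `ŵ := w ∘ neg` on
  `[-t₀, -inf s)`, whose reflection lies in `s`, and apply the upper-end lemma with `b := -inf s`
  (note `-inf s - t = (-t) - inf s`).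

Nothing Lorentzian is imported here; the geometric input (the escape law along a confined
zero-energy null geodesic) is produced by the engine of the line, which consumes this theorem
by name.
-/

noncomputable section

open Set

-- summit = problem name (D-0017)
set_option linter.dupNamespace false

namespace Summit.FinalStateConjecture.FinalStateConjecture.Theorems.ErgoregionBombModT

/-- **The finite-upper-end contradiction with an explicit end-point.**  On `[t₀, b)` (`t₀ < b`),
real functions with `φ' = u`, `u' = w`, `δ / (b - t)² ≤ w t` (`δ > 0`) and `|φ| ≤ M` cannot
coexist: brick R23 `stub_riccatiLogDivergence` with `ρ := (b - ·)⁻¹`, `v := ρ²`, `c := δ`, `C := 1`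
makes `φ` unbounded above on `[t₀, b)`. -/
private theorem false_of_upper_end {φ u w : ℝ → ℝ} {t₀ b δ M : ℝ} (ht₀b : t₀ < b) (hδ : 0 < δ)
    (hφ' : ∀ t ∈ Ico t₀ b, HasDerivAt φ (u t) t) (hu' : ∀ t ∈ Ico t₀ b, HasDerivAt u (w t) t)
    (hM : ∀ t ∈ Ico t₀ b, |φ t| ≤ M) (hw : ∀ t ∈ Ico t₀ b, δ / (b - t) ^ 2 ≤ w t) : False := by
  have key := stub_riccatiLogDivergence φ u w (fun t ↦ (b - t)⁻¹)
    (fun t ↦ (b - t)⁻¹ ^ 2) t₀ b δ 1 ht₀b hδ one_pos hφ' hu' ?_ ?_ ?_ ?_ ?_ M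
  · -- `M < φ t` against `|φ t| ≤ M`
    obtain ⟨t, ht, hMt⟩ := key
    have h1 := hM t ht
    have h2 := le_abs_self (φ t)
    linarith
  · -- `ρ' = ρ²`
    intro t ht
    have hbt : b - t ≠ 0 := (sub_pos.2 ht.2).ne'
    refine (((hasDerivAt_id' t).const_sub b).inv hbt).congr_deriv ?_
    rw [neg_neg, one_div, inv_pow]
  · -- `ρ > 0`
    intro t ht
    exact inv_pos.2 (sub_pos.2 ht.2)
  · -- `δ ρ² ≤ w`
    intro t ht
    rw [inv_pow, ← div_eq_mul_inv]
    exact hw t ht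
  · -- `|v| ≤ 1 · ρ²`
    intro t _
    rw [one_mul, abs_of_nonneg (sq_nonneg _)]
  · -- `ρ` is unbounded on `[t₀, b)`: `ρ ≥ n + 1` at `max t₀ (b - 1/(n+1))`
    intro n
    have hn1 : (0 : ℝ) < 1 / ((n : ℝ) + 1) := by positivity
    have hlt : max t₀ (b - 1 / ((n : ℝ) + 1)) < b := max_lt ht₀b (by linarith)
    refine ⟨max t₀ (b - 1 / ((n : ℝ) + 1)), ⟨le_max_left _ _, hlt⟩, ?_⟩
    have hle : b - max t₀ (b - 1 / ((n : ℝ) + 1)) ≤ 1 / ((n : ℝ) + 1) := by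
      have := le_max_right t₀ (b - 1 / ((n : ℝ) + 1))
      linarith
    have hpos : 0 < b - max t₀ (b - 1 / ((n : ℝ) + 1)) := sub_pos.2 hlt
    calc (n : ℝ) ≤ (n : ℝ) + 1 := by linarith
      _ = (1 / ((n : ℝ) + 1))⁻¹ := by rw [one_div, inv_inv]
      _ ≤ (b - max t₀ (b - 1 / ((n : ℝ) + 1)))⁻¹ := inv_anti₀ hpos hle

/-- **N3 (real line): logarithmic divergence at a finite end — both ends are infinite.**
On an open interval `s` (open, order-connected, non-empty), real functions with `φ' = u`, `u' = w`,
`|φ| ≤ M` and the escape law `δ / (sup s - t)² ≤ w t` (if `s` is bounded above), resp.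
`δ / (t - inf s)² ≤ w t` (if `s` is bounded below), `δ > 0`, force `s` to be unbounded above AND
below: at a finite end `u ≥ const + δ/(b - t)` and `φ ≥ const + δ log (1/(b - t)) → +∞` (brick R23),
against boundedness of `φ`; the lower end is the time reversal `t ↦ -t` of the upper end.
Registered stub `stub_logDivergenceAtFiniteEnd` (N3) of crux stmt-FinalStateConjecture-17838, line
`SketchIdeator4`. -/
theorem stub_logDivergenceAtFiniteEnd : ∀ (φ u w : ℝ → ℝ) (s : Set ℝ) (δ M : ℝ), IsOpen s → s.OrdConnected → s.Nonempty → 0 < δ → (∀ t ∈ s, HasDerivAt φ (u t) t) → (∀ t ∈ s, HasDerivAt u (w t) t) → (∀ t ∈ s, |φ t| ≤ M) → (BddAbove s → ∀ t ∈ s, δ / (sSup s - t) ^ 2 ≤ w t) → (BddBelow s → ∀ t ∈ s, δ / (t - sInf s) ^ 2 ≤ w t) → ¬ BddAbove s ∧ ¬ BddBelow s := by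
  intro φ u w s δ M hso hsc hne hδ hφ' hu' hM hup hlow
  obtain ⟨t₀, ht₀⟩ := hne
  -- `s` is open: `t₀ ± η/2 ∈ s`
  obtain ⟨η, hη, hball⟩ := Metric.isOpen_iff.1 hso t₀ ht₀
  have hplus : t₀ + η / 2 ∈ s := hball (by
    rw [Metric.mem_ball, Real.dist_eq, abs_sub_lt_iff]
    constructor <;> linarith)
  have hminus : t₀ - η / 2 ∈ s := hball (by
    rw [Metric.mem_ball, Real.dist_eq, abs_sub_lt_iff]
    constructor <;> linarith)
  constructor
  · -- UPPER END: `b := sup s`, `t₀ < b`, `[t₀, b) ⊆ s`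
    intro hab
    have ht₀b : t₀ < sSup s := by
      have := le_csSup hab hplus
      linarith
    have hsub : Ico t₀ (sSup s) ⊆ s := fun t ht ↦ by
      obtain ⟨t', ht's, htt'⟩ := exists_lt_of_lt_csSup ⟨t₀, ht₀⟩ ht.2
      exact hsc.out ht₀ ht's ⟨ht.1, htt'.le⟩
    exact false_of_upper_end ht₀b hδ (fun t ht ↦ hφ' t (hsub ht)) (fun t ht ↦ hu' t (hsub ht))
      (fun t ht ↦ hM t (hsub ht)) (fun t ht ↦ hup hab t (hsub ht))
  · -- LOWER END: reflect `t ↦ -t` and use the upper end with `b := - inf s`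
    intro hbb
    have hat₀ : sInf s < t₀ := by
      have := csInf_le hbb hminus
      linarith
    have hsub : ∀ t ∈ Ico (-t₀) (-sInf s), -t ∈ s := fun t ht ↦ by
      have h1 : sInf s < -t := by linarith [ht.2]
      obtain ⟨t', ht's, ht't⟩ := exists_lt_of_csInf_lt ⟨t₀, ht₀⟩ h1
      exact hsc.out ht's ht₀ ⟨ht't.le, by linarith [ht.1]⟩
    refine false_of_upper_end (φ := fun t ↦ φ (-t)) (u := fun t ↦ -u (-t))
      (w := fun t ↦ w (-t)) (t₀ := -t₀) (b := -sInf s) (δ := δ) (M := M)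
      (neg_lt_neg hat₀) hδ ?_ ?_ ?_ ?_
    · intro t ht
      exact ((hφ' (-t) (hsub t ht)).comp t (hasDerivAt_neg t)).congr_deriv (by ring)
    · intro t ht
      exact (((hu' (-t) (hsub t ht)).comp t (hasDerivAt_neg t)).neg).congr_deriv (by ring)
    · exact fun t ht ↦ hM (-t) (hsub t ht)
    · intro t ht
      have h := hlow hbb (-t) (hsub t ht)
      rwa [show -t - sInf s = -sInf s - t by ring] at h

end Summit.FinalStateConjecture.FinalStateConjecture.Theorems.ErgoregionBombModT
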